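import Literature.Geometry.Lorentzian.KerrTimelikeSpan
import Literature.Barriers.FinalStateConjecture.KerrSuperradiance

/-!
# Strategist s3 sketch — first lemma of crux idea `forbidden-annulus-superradiance`
(crux stmt-FinalStateConjecture-14310, children SingleZoneFarEnergyBound / SingleZoneNearILED, stubs RFB / RILED of
line `rest-frame-seams`).

For the tails-cut slowly rotating zone `g_χ(a)`, `|a| ≤ M/8`, every superradiant frequency `|ω| ≤ m·Ω_H` (`m ≥ 1` the
azimuthal number, `ℓ ≥ m`) lies strictly below the centrifugal barrier `(3/4)·ℓ(ℓ+1)/r²` on the whole surgery annulus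
`8M ≤ r ≤ 16M` (where `g_χ` differs from Kerr and from Minkowski; `f = 1 − 2Mχ/r ≥ 3/4` there and `χ′ ≤ 0`, so the
static radial potential is `≥ (3/4)ℓ(ℓ+1)/r²`): superradiant modes are classically FORBIDDEN where the surgery lives,
so a Moschidis-type superradiant bomb (arXiv:1608.02041, Thm 2: deformations at `r₀ ≫ 1` large in terms of `ω, a`)
cannot be built from the tails cut, and the `ψ♭` (superradiant) part of a Dafermos–Rodnianski-2011 decomposition meets
the non-Kerr region only in its elliptic zone.
-/

open Literature.Geometry.Lorentzian

namespace Summit.FinalStateConjecture.FinalStateConjecture.Cruxes.AdiabaticMultiKerrILED.StrategistS3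

/-- `r₊ ≥ (31/16) M` for `|a| ≤ M/8`. -/
theorem rPlus_ge_of_abs_le (M a : ℝ) (hM : 0 < M) (ha : |a| ≤ M / 8) :
    31 / 16 * M ≤ Kerr.rPlus M a := by
  unfold Kerr.rPlus
  have ha2 : a ^ 2 ≤ M ^ 2 / 64 := by
    have h1 : |a| ^ 2 ≤ (M / 8) ^ 2 := pow_le_pow_left₀ (abs_nonneg a) ha 2
    rw [sq_abs] at h1
    nlinarith
  have hs : 15 / 16 * M ≤ Real.sqrt (M ^ 2 - a ^ 2) := by
    apply Real.le_sqrt_of_sq_le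
    nlinarith
  linarith

/-- `|Ω_H| ≤ 1/(31 M)` for `|a| ≤ M/8` (`Ω_H = a/(2 M r₊)`). -/
theorem abs_horizonAngularVelocity_le (M a : ℝ) (hM : 0 < M) (ha : |a| ≤ M / 8) :
    |Kerr.horizonAngularVelocity M a| ≤ 1 / (31 * M) := by
  have hr := rPlus_ge_of_abs_le M a hM ha
  have hrpos : 0 < Kerr.rPlus M a := by linarith
  unfold Kerr.horizonAngularVelocity
  rw [abs_div, abs_of_pos (by positivity : 0 < 2 * M * Kerr.rPlus M a)]
  rw [div_le_div_iff₀ (by positivity) (by positivity)]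
  calc |a| * (31 * M) ≤ M / 8 * (31 * M) := by gcongr
    _ = 1 * (2 * M * (31 / 16 * M)) := by ring
    _ ≤ 1 * (2 * M * Kerr.rPlus M a) := by gcongr

/-- **First lemma (forbidden annulus for superradiant frequencies).** -/
theorem superradiant_forbidden_annulus (M a ω r : ℝ) (m ℓ : ℕ) (hM : 0 < M) (ha : |a| ≤ M / 8)
    (hm : 1 ≤ m) (hℓ : m ≤ ℓ) (hω : |ω| ≤ m * |Kerr.horizonAngularVelocity M a|)
    (hr : 8 * M ≤ r) (hr' : r ≤ 16 * M) :
    ω ^ 2 < 3 / 4 * ((ℓ : ℝ) * ((ℓ : ℝ) + 1)) / r ^ 2 := by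
  have hΩ := abs_horizonAngularVelocity_le M a hM ha
  have hm' : (1 : ℝ) ≤ m := by exact_mod_cast hm
  have hℓ' : (m : ℝ) ≤ ℓ := by exact_mod_cast hℓ
  have hω' : |ω| ≤ m * (1 / (31 * M)) := hω.trans (by gcongr)
  have hω2 : ω ^ 2 ≤ (m * (1 / (31 * M))) ^ 2 := by
    have := pow_le_pow_left₀ (abs_nonneg ω) hω' 2
    rwa [sq_abs] at this
  have hrpos : 0 < r := by linarith
  rw [lt_div_iff₀ (by positivity)]
  have h1 : (m * (1 / (31 * M))) ^ 2 * r ^ 2 ≤ (m : ℝ) ^ 2 * 256 / 961 := by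
    have : (m * (1 / (31 * M))) ^ 2 * r ^ 2 = (m : ℝ) ^ 2 * (r / M) ^ 2 / 961 := by
      field_simp
      ring
    rw [this]
    have hrM : r / M ≤ 16 := by rw [div_le_iff₀ hM]; linarith
    have hrM0 : 0 ≤ r / M := by positivity
    have : (r / M) ^ 2 ≤ 256 := by nlinarith
    have hm0 : (0 : ℝ) ≤ (m : ℝ) ^ 2 := by positivity
    nlinarith
  calc ω ^ 2 * r ^ 2 ≤ (m * (1 / (31 * M))) ^ 2 * r ^ 2 := by gcongr
    _ ≤ (m : ℝ) ^ 2 * 256 / 961 := h1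
    _ < 3 / 4 * ((ℓ : ℝ) * ((ℓ : ℝ) + 1)) := by nlinarith

end Summit.FinalStateConjecture.FinalStateConjecture.Cruxes.AdiabaticMultiKerrILED.StrategistS3
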